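import Summits.QuantumAdvantage.QuantumAdvantage.Theses.CubicForrelation
import Literature.Computability.QuantumComplexity.SignedCubicForrelation
import Literature.Computability.QuantumComplexity.ForrelationSignTransport
import Literature.Computability.QuantumComplexity.ForrelationMSubspaceDuality
import Literature.Computability.Complexity.PromiseBPPFromFPDecider
import HarnessLib

/-!
# Skeleton line `stationary-flat-sign` for crux `SignedExactCubicForrelationNotPrBPP` (stmt-QuantumAdvantage-13932)

Route `QuantumAdvantage/CubicForrelation`, crux r3 (rank 3):
`S := SignedExactCubicForrelationNotPrBPP` — the SIGNED EXACT slice of cubic 2-fold Forrelation (yes `Φ = 1`: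
`b` cubic bent with cubic dual `a`; no `Φ = -1`: `a = b̃ ⊕ 1`; `k = 2`, `n` even, `B₂`-circuits of 𝔽₂-degree `≤ 3`)
is NOT in `PromiseBPP'`. Planner skeleton, crux-plan round 1
(planner-cruxplan-stmt-QuantumAdvantage-13932-stationary-flat-sign-0, 2026-08-16); idea card
`Ideas/stationary-flat-sign.md` (ideator 1); triage r1: 3 × pass (merge notes: readout `≈ window-sign-leak`, finder
`≈ oil-slice-radicals` / `dual-pingpong-frame`; "cards 1–4 + Disproof.lean are ONE refutation line"). Line card:
`Lines/stationary-flat-sign.md`.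

## Direction: this line REFUTES the crux

The idea decides the sign classically on the Maiorana–McFarland side and, with the route's crux r5
`ExactPairsMaioranaMcFarland`, on the whole exact slice. A refutation skeleton cannot conclude `S` by name, so this
seat FILED THE NEGATION as a route statement (support, rank 9): `SignedExactCubicForrelationInPrBPP`
(stmt-QuantumAdvantage-14671; rendered into the route file by the gate at 2026-08-16T05:55Z) — literally the `S` signature
with `∉` replaced by `∈`, `rfl`-equal to `signedExactCubicForrelationProblem 2 ∈ PromiseBPP'`. The composition
`SignedExactCubicForrelationInPrBPP_of` concludes THAT ROUTE DECL by name (kernel-checked, no `sorry`; skeleton audit run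
with `--crux stmt-QuantumAdvantage-13932 --crux-decl …Theses.CubicForrelation.SignedExactCubicForrelationInPrBPP`), and
`SignedExactCubicForrelationNotPrBPP_false_of` records `¬ S` against the crux decl itself. The sibling r3 skeletons
(`dual_pingpong_frame`, `oil_slice_radicals`) conclude `¬ S` only; they can retarget to the same decl.
(The r7 skeletons `Cruxes/SignedCubicForrelationInPrBPP/Lines/{seed_to_sign,polar_radical_seeds}.lean` reach the same
statement as a bonus from the r7 side; here it is the target, with the finder's open content split along THIS card.)

## The line: the sign is the phase at one critical Lagrangian half-flat; bent-permutation differentials leak the flat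

* LEVER 1 — `FlatTransfer` (stub 1, PROVABLE NOW from the landed `DerivativeWalsh.sign_transport` /
  `coset_sum_eq_of_forrelation_eq_one/neg_one` + `perp_perp_eq_of_sq`): for an exact pair (`Φ(a,b) = ±1`) and ANY
  half-dimensional subspace `U` (`0 ∈ U`, `⊕`-closed, `|U|² = 2ⁿ`) such that `b` is AFFINE on the flat `t ⊕ U` with slope
  `s` (`(-1)^{b(t⊕u)} = (-1)^{b(t)} (-1)^{s·u}`), `Φ(a,b) = (-1)^{a(s)} (-1)^{s·t} (-1)^{b(t)}` — ONE evaluation of each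
  circuit once ONE half-flat of either function is known (Poisson summation for the re-twisted pair
  `(a(s ⊕ ·), (-1)^{b} (-1)^{s·})`; no inversion of the hidden permutation, no dual formula, `U` need not be an
  M-subspace). So SIGN `≤ᴾ` FIND-ONE-HALF-FLAT. Numerically: 29 147 + 293 checks, 0 failures (triage r1-3 §A, card).
* LEVER 2 — `PolarLeak` (stub 2, finite linear algebra, TRUE for ANY coordinatewise-quadratic `π`, bijective or not —
  triage r1-2 sharpening (a)): for `b = y'·π(y'') ⊕ h(y'')` and every direction `w` with `w'' ≠ 0` the polar radical
  `rad T_b(w,·,·)` contains a non-zero vector of the hidden flat `U₀ = {y'' = 0}` (the linear part `A_{w''}` of the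
  differential `D_{w''}π` kills `w''`, so `A_{w''}ᵀ` has a kernel), and the JUNK BOUND `|rad T_b(z,·,·)| ≤ |ker A_{z''}|²`
  (`rank [[0,A],[Aᵀ,C]] ≥ 2·rank A`) behind the half-rank filter "keep `y` with `rank T_b(y,·,·) ≤ m`".
* THE OPEN MATHEMATICS, split along the card's Transfer `C⁺`:
  - `BQDichotomy` (stub 3, pure finite-field, CENSUS-CHECKABLE; the card's "BQ∞ = ∅"): every quadratic permutation
    `π` of `𝔽₂^m` with quadratic inverse `σ` is DECOMPOSABLE (a product map after linear changes of coordinates) OR has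
    an AFFINE DIRECTION (`B_π(w,·) = 0`, `w ≠ 0`; equivalently for `σ`) OR has a RANK-ISOLATING differential
    (`|ker B_π(w,·)| = 2` or `|ker B_σ(w,·)| = 2` for some `w ≠ 0`). Evidence: exhaustive at `m = 3` (all 40 320
    permutations of `𝔽₂³`), 4 000/4 000 sampled biquadratic permutations of `𝔽₂⁴`, the triage census kit j012921
    (`m ≤ 5`: every class has `dim K ≥ 1` or `kmin = 1`); `cube × cube` (`m = 6`) needs the DEC branch. No member of the
    residual class is known.
  - `FinderOfDichotomy` (stub 4, OPEN, the HARDEST stub — "worst-case finder over all biquadratic `π`", Disproof (c)2,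
    BIISO §6): `PolarLeak → BQDichotomy → MMFlatFinder`, where `MMFlatFinder` = an `FP` function that, on every exact
    cubic two-circuit instance whose `g = C₁` HAS a half-dimensional M-subspace, outputs with probability `≥ 1/2` a
    certified half-flat `(t, s, U)` of `g`. Road (card §3, regimes): A — `Rad T_b ≠ 0` / affine directions: quotient +
    Witt; B — rank-isolating directions: `rad M_w = {0, u₀, w, w ⊕ u₀}` hands over the flat vector `u₀` (junk bound),
    collect, close by `E(S) = {u : T_b(u,S,·) = 0, D_uD_s b(0) = 0}`; DEC — centroid / chunk accumulation, then per
    block; plus the two-tensor ping-pong on `(T_a, T_b)`. Four implementations (biiso.py v3, msub_attack.py,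
    kernel_attack.py, flatsign4.py), > 600 planted instances `n ≤ 96`, 0 wrong signs; no worst-case theorem.
* PLUMBING — `SignReadout` (stub 5, L, true on paper): `FlatTransfer → MMFlatFinder → ExactPairsHaveMSubspace →
  signedExactCubicForrelationProblem 2 ∈ PromiseBPP'`: run the finder twice, CERTIFY the witness (rank `n/2` by
  elimination; affinity of a cubic on a flat is checked on sums of `≤ 3` generators), output
  `(-1)^{a(s)} (-1)^{s·t} (-1)^{b(t)}` — DETERMINISTIC given the flat (no sampling), correct by `FlatTransfer` on YES and
  NO instances alike (the NO side `Φ = -1` uses `ExactPairsHaveMSubspace` for `(¬a, b)`), error only from finder failure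
  `≤ 1/4 < 1/3`; membership by `PromiseProblem.mem_PromiseBPP'_of_fp_decider` (FP plumbing as in
  `CubicForrelationEstimatorMachine.lean`, which landed r4).
* TOTALITY — `DillonOfMM` (stub 6, M, provable now): route crux r5 `ExactPairsMaioranaMcFarland` (stmt-2205, used BY
  NAME in the composition, not re-filed) ⇒ `ExactPairsHaveMSubspace` (the affine image of the coordinate half-space of
  the MM normal form is an M-subspace: Dillon's criterion, Carlet 2020 Prop. 54, direction MM ⇒ M-subspace).

`SignedExactCubicForrelationInPrBPP_of` : stubs 1–6 + r5 ⟹ `SignedExactCubicForrelationInPrBPP` (the negation item's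
route decl, by name; body `h₅ h₁ (h₄ h₂ h₃) (h₆ h5)`), and `SignedExactCubicForrelationNotPrBPP_false_of` : the same ⟹ `¬ S`
(the crux decl itself). Stub names carry no clash with the sibling lines' registered stubs on the same crux item
(`stub_flatSignReadout`, `stub_dillonHalfSpace` instead of the generic `stub_flatSignReadout` / `stub_dillonHalfSpace`).

## Disproof used (`Cruxes/SignedExactCubicForrelationNotPrBPP/Disproof.lean`, cdisprove cycle 1) and negatives

* (a) ★ `sign_transport`, `coset_sum_eq_of_forrelation_eq_one/neg_one` (LANDED `ForrelationSignTransport.lean`) —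
  USED: `FlatTransfer` is ★ for the re-twisted pair at `U := U^⊥`, `r := t`; the skeleton IMPORTS the landed file
  (triage r1-2 sharpening (b)) instead of restating the readout as open.
* (a′) `dual_affine_on_perp_cosets` (LANDED `ForrelationMSubspaceDuality.lean`) — USED by stub 5's NO side and by the
  finder's certification on the `a` side (`FlatDuality` of the card is its `V := U` instance); imported.
* (c) honest residue 1–3 — HONOURED: residue 1 (plumbing) = stub 5, now largely paid by
  `CubicForrelationEstimatorMachine.lean`; residue 2 (worst case over MM pairs) = stubs 3–4, named and split; residue 3
  (non-MM exact pairs) = r5 by name + stub 6.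
* (d) refuted strengthenings S⁺¹–S⁺⁴ — no stub asks for hardness of anything; S⁺¹ ("hard even given an M-subspace as
  advice") is exactly what `FlatTransfer` + stub 5 deny. No `_false_without_` theorem exists for this crux (S has no
  hypotheses), so there is no hypothesis-use obligation to honour.
* `Theorems/SignedCubicForrelationInPrBPP/Negative/GoldCube.lean` (`not_biquadraticPermsHaveAffineComponent`, landed
  from the r7 disprover) — CONSISTENT: `BQDichotomy` does NOT claim an affine component/direction for every biquadratic
  `π`; the Gold cube falls under its rank-isolating branch (`|ker B_π(w,·)| = 2` for all `w ≠ 0`).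
* `ledger negatives --problem QuantumAdvantage` (5 refuted statements: SpinorFlattening 1244, CubicStability 2202,
  KummerSector 1615, SeparableFrames 9863, ShorLocallyDark 8592) — none concerns a `Φ = ±1` lever; no stub is an
  instance of a refuted statement (CubicStability is the `3/5`-localisation, not used: this line never leaves the
  exact slice).
-/

noncomputable section

set_option linter.dupNamespace false

namespace Summit.QuantumAdvantage.QuantumAdvantage.Cruxes.SignedExactCubicForrelationNotPrBPP.StationaryFlatSign

open Finset
open Literature.Computability.Complexity Literature.Computability.QuantumComplexity
open Literature.Computability.QuantumComplexity.BuzetChailloux (bxor zeroVec)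
open Summit.QuantumAdvantage.QuantumAdvantage.Theses.CubicForrelation

/-! ### Vocabulary 1: subspaces and affine half-flats of `𝔽₂ⁿ` (bit vectors, finsets) -/

/-- `U ⊆ 𝔽₂ⁿ` is a linear subspace: contains `0`, closed under `⊕`. -/
def IsSubspace {n : ℕ} (U : Finset (Fin n → Bool)) : Prop :=
  zeroVec ∈ U ∧ ∀ u ∈ U, ∀ v ∈ U, bxor u v ∈ U

/-- `U` is HALF-DIMENSIONAL: `|U|² = 2ⁿ` (real form, verbatim the hypothesis `hcard` of the landed
`DerivativeWalsh.dual_affine_on_perp_cosets` / `perp_perp_eq_of_sq`). -/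
def IsHalfDim {n : ℕ} (U : Finset (Fin n → Bool)) : Prop :=
  (U.card : ℝ) ^ 2 = (2 : ℝ) ^ n

/-- `b` is AFFINE on the flat `t ⊕ U` with SLOPE `s`: `(-1)^{b(t ⊕ u)} = (-1)^{b(t)} · (-1)^{s·u}` for all `u ∈ U`
(a "critical Lagrangian flat" of the phase `a(x) + x·y + b(y)` in the card's language). -/
def IsAffineFlat {n : ℕ} (b : (Fin n → Bool) → Bool) (t s : Fin n → Bool) (U : Finset (Fin n → Bool)) : Prop :=
  ∀ u ∈ U, signOf (b (bxor t u)) = signOf (b t) * twist s u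

/-- **FLAT TRANSFER** (lever 1 of the card; `Sketch.lean` of ideator 1, hypotheses aligned with the landed files).
For an exactly (anti-)forrelated pair and ANY half-dimensional subspace `U` on a coset `t ⊕ U` of which `b` is affine
with slope `s`: `Φ(a,b) = (-1)^{a(s)} (-1)^{s·t} (-1)^{b(t)}`. Proof route (3 lines on paper): ★ = `sign_transport` for
the re-twisted pair `(x ↦ a(s ⊕ x), y ↦ (-1)^{b(y)} (-1)^{s·y})` (same `Φ`), subspace `U^⊥`, shift `t`; the `b`-side
coset sum is `± 2ⁿ/|U|·…` termwise, forcing the `a`-side sum over `U^⊥⊥ = U`… (`perp_perp_eq_of_sq`) to be `±|U^⊥|`,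
whose `x = 0` term gives the sign. -/
def FlatTransfer : Prop :=
  ∀ (n : ℕ) (a b : (Fin n → Bool) → Bool) (U : Finset (Fin n → Bool)) (s t : Fin n → Bool),
    (forrelation a b = 1 ∨ forrelation a b = -1) → IsSubspace U → IsHalfDim U → IsAffineFlat b t s U →
      forrelation a b = signOf (a s) * twist s t * signOf (b t)

/-! ### Vocabulary 2: Maiorana–McFarland coordinates, polar radicals, differentials of the hidden map -/

/-- The bit `u·v = ∑ᵢ uᵢ vᵢ (mod 2)`. -/
def bdot {m : ℕ} (u v : Fin m → Bool) : Bool :=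
  decide ((univ.filter fun i => u i && v i).card % 2 = 1)

/-- First block `y'` of `y ∈ 𝔽₂^{m+m}` (coordinates `Fin.castAdd m i`, i.e. `Fin.append y' y'' ↦ y'`). -/
def lo {m : ℕ} (y : Fin (m + m) → Bool) : Fin m → Bool := fun i => y (Fin.castAdd m i)

/-- Second block `y''` of `y ∈ 𝔽₂^{m+m}` (coordinates `Fin.natAdd m i`, i.e. `Fin.append y' y'' ↦ y''`). -/
def hi {m : ℕ} (y : Fin (m + m) → Bool) : Fin m → Bool := fun i => y (Fin.natAdd m i)

/-- The Maiorana–McFarland function `b(y', y'') = y'·π(y'') ⊕ h(y'')` on `𝔽₂^{m+m}` (any map `π`, any `h`; bent iff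
`π` is a permutation). Its hidden half-flat is `U₀ = {y'' = 0} = {Fin.append u' 0}`, an M-subspace: `b` is affine on
every coset `(y', t'') ⊕ U₀` with slope read off `π(t'')`. -/
def mmFun {m : ℕ} (π : (Fin m → Bool) → (Fin m → Bool)) (h : (Fin m → Bool) → Bool) :
    (Fin (m + m) → Bool) → Bool :=
  fun y => (bdot (lo y) (π (hi y)) ^^ h (hi y))

/-- Second difference `D_u D_v b (y)`. -/
def D2 {n : ℕ} (b : (Fin n → Bool) → Bool) (u v y : Fin n → Bool) : Bool :=
  (b y ^^ b (bxor y u) ^^ b (bxor y v) ^^ b (bxor y (bxor u v)))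

/-- `u` lies in the POLAR RADICAL of `b` at `w`: `D_w D_u b` is a constant function. For cubic `b` this says
`T_b(w,u,·) = 0` for the third-derivative trilinear form `T_b`, i.e. `u ∈ rad T_b(w,·,·)` — computable by linear algebra
on the ANF. -/
def InPolarRad {n : ℕ} (b : (Fin n → Bool) → Bool) (w u : Fin n → Bool) : Prop :=
  ∀ y, D2 b w u y = D2 b w u zeroVec

/-- The bilinear differential of a map `π : 𝔽₂^m → 𝔽₂^m`: `B_π(w,v) = π(w ⊕ v) ⊕ π(w) ⊕ π(v) ⊕ π(0)` (for
coordinatewise-quadratic `π` it is bi-additive and alternating: `B_π(w,w) = 0`). -/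
def bil {m : ℕ} (π : (Fin m → Bool) → (Fin m → Bool)) (w v : Fin m → Bool) : Fin m → Bool :=
  bxor (bxor (π (bxor w v)) (π w)) (bxor (π v) (π zeroVec))

/-- `|ker B_π(w,·)|` — the size of the kernel of the linear part `A_w` of the differential `D_w π` (`≥ 2` for `w ≠ 0`
since `w ∈ ker A_w`; `= 2^m` iff `w` is an affine direction; `= 2` iff `w` is RANK-ISOLATING). -/
def dkerCard {m : ℕ} (π : (Fin m → Bool) → (Fin m → Bool)) (w : Fin m → Bool) : ℕ :=
  (univ.filter fun v => bil π w v = zeroVec).card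

/-- `π` is coordinatewise of 𝔽₂-degree `≤ 2`. -/
def IsQuadraticMap {m : ℕ} (π : (Fin m → Bool) → (Fin m → Bool)) : Prop :=
  ∀ i, IsDegLeFun 2 (fun x => π x i)

/-- **POLAR LEAK and JUNK BOUND** (lever 2 of the card, (3a)–(3b); = Negative-note F1 / `SliceRadicalOil` /
`PolarLeak` of the sibling cards; finite linear algebra over `𝔽₂`, TRUE for any coordinatewise-quadratic `π` and cubic
`h` — bijectivity of `π` is NOT needed, triage r1-2 (a)). For `b = mmFun π h` on `𝔽₂^{m+m}`:
(leak) every direction `w` with `w'' ≠ 0` has a NON-ZERO flat vector `(u', 0)` in its polar radical (in coordinates: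
`rad T_b(w,·,·) ∩ U₀ = ker A_{w''}ᵀ × 0` and `A_{w''} w'' = 0`);
(junk bound) for every `z`, `|rad T_b(z,·,·)| ≤ |ker A_{z''}|²` (`T_b(z,·,·) = [[0, A_{z''}],[A_{z''}ᵀ, C]]` has rank
`≥ 2·rank A_{z''}`), so a junk vector `z` (`z'' ≠ 0`) passes the half-rank filter `|rad T_b(z,·,·)| ≥ 2^m` only if
`|ker A_{z''}|² ≥ 2^m`. -/
def PolarLeak : Prop :=
  ∀ (m : ℕ) (π : (Fin m → Bool) → (Fin m → Bool)) (h : (Fin m → Bool) → Bool),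
    IsQuadraticMap π → IsDegLeFun 3 h →
      (∀ w : Fin (m + m) → Bool, hi w ≠ zeroVec →
          ∃ u' : Fin m → Bool, u' ≠ zeroVec ∧ InPolarRad (mmFun π h) w (Fin.append u' zeroVec)) ∧
      (∀ z : Fin (m + m) → Bool,
          (@Finset.filter _ (fun u => InPolarRad (mmFun π h) z u) (Classical.decPred _) univ).card ≤
            dkerCard π (hi z) ^ 2)

/-! ### Vocabulary 3: the dichotomy for biquadratic permutations (the card's `C⁺`, triage r1-2 census object) -/

/-- `π` has an AFFINE DIRECTION: some `w ≠ 0` with `B_π(w,·) = 0` (`D_w π` constant; `K(π) ≠ 0` in the card). For a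
permutation this holds iff it holds for the inverse. -/
def HasAffineDirection {m : ℕ} (π : (Fin m → Bool) → (Fin m → Bool)) : Prop :=
  ∃ w : Fin m → Bool, w ≠ zeroVec ∧ ∀ v, bil π w v = zeroVec

/-- `π` has a RANK-ISOLATING DIRECTION: some `w ≠ 0` whose differential kernel is exactly `{0, w}`. -/
def HasIsolatingDirection {m : ℕ} (π : (Fin m → Bool) → (Fin m → Bool)) : Prop :=
  ∃ w : Fin m → Bool, w ≠ zeroVec ∧ dkerCard π w = 2

/-- `L` is additive (`𝔽₂`-linear). -/
def IsAdditive {m : ℕ} (L : (Fin m → Bool) → (Fin m → Bool)) : Prop :=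
  ∀ x y, L (bxor x y) = bxor (L x) (L y)

/-- `π` is DECOMPOSABLE: after linear changes of coordinates `L` (source) and `R` (target) it is a product map for the
non-trivial coordinate splitting `{i < k} ⊔ {k ≤ i}` — the first `k` output bits depend only on the first `k` input
bits and the last `m - k` only on the last `m - k` (`π ≃ π₁ × π₂`; e.g. products of `𝔽₈`-cubes). -/
def Decomposable {m : ℕ} (π : (Fin m → Bool) → (Fin m → Bool)) : Prop :=
  ∃ (L R : (Fin m → Bool) ≃ (Fin m → Bool)), IsAdditive L ∧ IsAdditive R ∧ ∃ k : ℕ, 0 < k ∧ k < m ∧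
    (∀ x x' : Fin m → Bool, (∀ i : Fin m, (i : ℕ) < k → x i = x' i) →
        ∀ i : Fin m, (i : ℕ) < k → R (π (L x)) i = R (π (L x')) i) ∧
    (∀ x x' : Fin m → Bool, (∀ i : Fin m, k ≤ (i : ℕ) → x i = x' i) →
        ∀ i : Fin m, k ≤ (i : ℕ) → R (π (L x)) i = R (π (L x')) i)

/-- **BQ-DICHOTOMY** ("BQ∞ = ∅", the card's Transfer `C⁺` in the form fixed by triage r1-2 §2): every quadratic
permutation `π` of `𝔽₂^m` (`m ≥ 1`) with quadratic inverse `σ` is decomposable, or has an affine direction, or has a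
rank-isolating differential on one of its two sides. A finite-field statement with no complexity theory in it;
exhaustively true at `m = 3`, true on every sampled class at `m = 4, 5`; `cube × cube` uses the first branch. -/
def BQDichotomy : Prop :=
  ∀ (m : ℕ) (π σ : (Fin m → Bool) → (Fin m → Bool)), 0 < m →
    (∀ x, σ (π x) = x) → (∀ y, π (σ y) = y) → IsQuadraticMap π → IsQuadraticMap σ →
      Decomposable π ∨ HasAffineDirection π ∨ HasIsolatingDirection π ∨ HasIsolatingDirection σ

/-! ### Vocabulary 4: M-subspaces (verbatim the sibling line `polar_radical_seeds`) and the finder's output -/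

/-- All second differences of `g` along `V` vanish (`g` affine on every coset of `V`): the M-subspace condition,
verbatim the hypothesis `hM` of `DerivativeWalsh.dual_affine_on_perp_cosets`. -/
def AffineOnCosets {n : ℕ} (g : (Fin n → Bool) → Bool) (V : Finset (Fin n → Bool)) : Prop :=
  ∀ u ∈ V, ∀ v ∈ V, ∀ y, (g y ^^ g (bxor y u) ^^ g (bxor y v) ^^ g (bxor y (bxor u v))) = false

/-- `g` HAS a half-dimensional M-subspace (Dillon's criterion for the completed Maiorana–McFarland class,
Carlet 2020 Prop. 54; verbatim `PolarRadicalSeeds.HasMSubspace`). -/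
def HasMSubspace {n : ℕ} (g : (Fin n → Bool) → Bool) : Prop :=
  ∃ V : Finset (Fin n → Bool), zeroVec ∈ V ∧ (∀ x ∈ V, ∀ y ∈ V, bxor x y ∈ V) ∧
    (V.card : ℝ) ^ 2 = (2 : ℝ) ^ n ∧ AffineOnCosets g V

/-- Exactly forrelated cubic pairs lie on the MM side: `g` has a half-dimensional M-subspace (crux r5 in Dillon form;
verbatim `PolarRadicalSeeds.ExactPairsHaveMSubspace`). -/
def ExactPairsHaveMSubspace : Prop :=
  ∀ (n : ℕ), Even n → ∀ f g : (Fin n → Bool) → Bool, IsDegLeFun 3 f → IsDegLeFun 3 g →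
    forrelation f g = 1 → HasMSubspace g

/-- The `k`-th `n`-bit block of a bit string (zero-padded). -/
def blockAt (n : ℕ) (s : List Bool) (k : ℕ) : Fin n → Bool := fun i => s.getD (k * n + i) false

/-- The `⊕`-span of a list of vectors, as a finset (always a subspace). -/
def spanOf {n : ℕ} : List (Fin n → Bool) → Finset (Fin n → Bool)
  | [] => {zeroVec}
  | e :: es => spanOf es ∪ (spanOf es).image (bxor e)

/-- Output convention of the finder: block 0 = base point `t`, block 1 = slope `s`, blocks 2… = generators of `U`. -/
def baseOf (n : ℕ) (s : List Bool) : Fin n → Bool := blockAt n s 0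

/-- The slope `s` read from a finder's output. -/
def slopeOf (n : ℕ) (s : List Bool) : Fin n → Bool := blockAt n s 1

/-- The direction space `U` read from a finder's output. -/
def dirOf (n : ℕ) (s : List Bool) : Finset (Fin n → Bool) :=
  spanOf ((List.range (s.length / n - 2)).map fun k => blockAt n s (k + 2))

/-- The output `out` is a HALF-FLAT WITNESS for the second function `g = C₁` of the two-circuit instance `I`: `U` is
half-dimensional and `g` is affine on `t ⊕ U` with slope `s` — exactly what `FlatTransfer` consumes (the span is a
subspace for free), and a poly-time CERTIFIABLE condition for cubic `g`. -/
def FlatWitness (I : KForrelationInstance) (hk : I.k = 2) (out : List Bool) : Prop :=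
  IsHalfDim (dirOf I.n out) ∧
    IsAffineFlat (I.C (Fin.cast hk.symm 1)).eval (baseOf I.n out) (slopeOf I.n out) (dirOf I.n out)

/-- **MM FLAT FINDER ∈ FBPP** (the worst-case finder, stated by its certified OUTPUT): a polynomial-time string
function `find` on `⟨instance, coins⟩` and a coin polynomial `p` such that on every EXACT cubic two-circuit instance
(`B₂`-circuits, `n` even, both functions of 𝔽₂-degree `≤ 3`, `Φ² = 1`) whose second function HAS a half-dimensional
M-subspace, at least half of the coin strings make `find` output a half-flat witness. (Las Vegas in substance: the
output is verifiable, so `1/2` is amplified downstream.) -/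
def MMFlatFinder : Prop :=
  ∃ find : List Bool → List Bool, find ∈ FP ∧ ∃ p : Polynomial ℕ,
    ∀ (I : KForrelationInstance) (hk : I.k = 2), Even I.n → I.IsOverB2 →
      (∀ i, IsDegLeFun 3 (I.C i).eval) → I.value ^ 2 = 1 →
      HasMSubspace (I.C (Fin.cast hk.symm 1)).eval →
        (1 / 2 : ℝ) ≤ uniformProb (p.eval I.encode.length) {y | FlatWitness I hk (find (boolPair I.encode y))}

/-! ### The open / composite statements of the line -/

/-- **FINDER FROM THE DICHOTOMY** (algorithmic content of the card's §3: regime A — radical / affine directions,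
quotient + Witt; regime B — rank-isolating directions hand over flat vectors one at a time (`PolarLeak` + junk bound),
closed up by `E(S)`; DEC — centroid / chunk accumulation then blockwise; dual side via `σ`). -/
def FinderOfDichotomy : Prop :=
  PolarLeak → BQDichotomy → MMFlatFinder

/-- **SIGN READOUT** (plumbing): with `FlatTransfer`, a flat finder for the MM side and M-subspaces for all exact
cubic pairs, the signed exact slice is in `PromiseBPP'` — run `find` twice, certify, output
`(-1)^{a(s)} (-1)^{s·t} (-1)^{b(t)}`; `mem_PromiseBPP'_of_fp_decider`. -/
def SignReadout : Prop :=
  FlatTransfer → MMFlatFinder → ExactPairsHaveMSubspace → signedExactCubicForrelationProblem 2 ∈ PromiseBPP'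

/-- **DILLON FORM OF r5**: the route crux `ExactPairsMaioranaMcFarland` (stmt-QuantumAdvantage-2205: exact cubic pairs
are completed-MM, `g ∘ e (y', y'') = y'·perm(y'') + h(y'')` with `e` affine) gives every exactly forrelated cubic `g` a
half-dimensional M-subspace (the `e`-image of `{y'' = 0}`, translated to `0`). -/
def DillonOfMM : Prop :=
  ExactPairsMaioranaMcFarland → ExactPairsHaveMSubspace

/-! ### The stubs (registered obligations; `sorry` lives only here) -/

/-- STUB 1 — FLAT TRANSFER (M, PROVABLE NOW: `DerivativeWalsh.sign_transport` / `coset_sum_eq_of_forrelation_eq_one`,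
`…_neg_one`, `perp_perp_eq_of_sq`, `all_eq_of_sum_eq_card`, all landed). The card's lever; odd in `(a,b)` as it must
be (`dwt_signOf_not`: every even functional is sign-blind). -/
theorem stub_flatTransfer : FlatTransfer := by
  sorry

/-- STUB 2 — POLAR LEAK + JUNK BOUND (M, finite linear algebra over `𝔽₂`; exhaustively verified for all directions at
`n ≤ 10` and sampled at `n = 12`, triage r1-3 §B; the first lemma of the finder). -/
theorem stub_polarLeak : PolarLeak := by
  sorry

/-- STUB 3 — BQ-DICHOTOMY (L, OPEN, pure finite field; the most INFORMATIVE stub and the cheapest to falsify: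
exhaustive at `m = 3` (40 320/40 320), 4 000/4 000 at `m = 4`, triage census j012921 at `m ≤ 5`; first open case `m = 6`
beyond products). Refuted by ONE indecomposable biquadratic `π` with `K(π) = 0` and all differential kernels of
dimension `≥ 2` on both sides — which would be the route's first planted hard family for r3. -/
theorem stub_bqDichotomy : BQDichotomy := by
  sorry

/-- STUB 4 — FINDER FROM THE DICHOTOMY (XL, OPEN, the HARDEST stub: uniform running time of the certified finder over
ALL biquadratic `π` and admissible `h`; density of usable directions in regime B, closure completeness
(`E(S) = U₀` once `dim S'' > max κ`), decomposable `π` with a COUPLED cubic `h`). Every implementation succeeds on every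
family tried (`n ≤ 96`); no proof. Refuted by an MM family on which every poly-time finder fails — i.e. by r3 on the
MM side. -/
theorem stub_finderOfDichotomy : FinderOfDichotomy := by
  sorry

/-- STUB 5 — SIGN READOUT (L, true on paper, risk formal only: certification of a half-flat witness for cubic `g` in
`FP`, two finder runs (`≥ 3/4`), the three evaluations `a(s)`, `s·t`, `b(t)`, `FlatTransfer` on both sides of the
promise (`Φ = -1`: apply `ExactPairsHaveMSubspace` to `(¬a, b)`, `forrelation_not_left`-type sign flip),
`PromiseProblem.mem_PromiseBPP'_of_fp_decider`; FP kit of `CubicForrelationEstimatorMachine.lean`). -/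
theorem stub_flatSignReadout : SignReadout := by
  sorry

/-- STUB 6 — DILLON FORM OF r5 (M, provable now: unpack the affine bijection `e` (matrix `M`, shift `c`) of
`ExactPairsMaioranaMcFarland`, take `V :=` the image of `{Fin.append y' 0}` under the linear part of `e`; `g` is affine
on every coset of `V` because `y' ↦ y'·perm(y'') + h(y'')` is; `|V|² = 2^{m+m}`). -/
theorem stub_dillonHalfSpace : DillonOfMM := by
  sorry

/-! ### Name-keyed aliases of the stub statements (the skeleton audit admits a hypothesis of the composition only if
its head constant is a registered obligation or is named like a declared stub) -/
namespace Registered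

/-- Alias of `FlatTransfer`. -/
abbrev stub_flatTransfer : Prop := FlatTransfer
/-- Alias of `PolarLeak`. -/
abbrev stub_polarLeak : Prop := PolarLeak
/-- Alias of `BQDichotomy`. -/
abbrev stub_bqDichotomy : Prop := BQDichotomy
/-- Alias of `FinderOfDichotomy`. -/
abbrev stub_finderOfDichotomy : Prop := FinderOfDichotomy
/-- Alias of `SignReadout`. -/
abbrev stub_flatSignReadout : Prop := SignReadout
/-- Alias of `DillonOfMM`. -/
abbrev stub_dillonHalfSpace : Prop := DillonOfMM

end Registered

/-! ### The composition: the stubs (+ crux r5 by name) imply the negation item BY NAME, hence `¬` crux r3 -/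

/-- **`SignedExactCubicForrelationInPrBPP` (route decl of item stmt-QuantumAdvantage-14671) from the six stubs and r5.**
Finder (stubs 2–4) + readout (stubs 1, 5) on the MM side, made total by r5 in Dillon form (stub 6); the last step is
`rfl` (`signedExactCubicForrelationProblem_two_eq`). -/
theorem SignedExactCubicForrelationInPrBPP_of (h₁ : Registered.stub_flatTransfer)
    (h₂ : Registered.stub_polarLeak) (h₃ : Registered.stub_bqDichotomy) (h₄ : Registered.stub_finderOfDichotomy)
    (h₅ : Registered.stub_flatSignReadout) (h₆ : Registered.stub_dillonHalfSpace)
    (h5 : ExactPairsMaioranaMcFarland) : SignedExactCubicForrelationInPrBPP :=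
  h₅ h₁ (h₄ h₂ h₃) (h₆ h5)

/-- Wiring check: the declared stubs feed the composition as stated. -/
example (h5 : ExactPairsMaioranaMcFarland) : SignedExactCubicForrelationInPrBPP :=
  SignedExactCubicForrelationInPrBPP_of stub_flatTransfer stub_polarLeak stub_bqDichotomy stub_finderOfDichotomy
    stub_flatSignReadout stub_dillonHalfSpace h5

/-- **The crux r3 is FALSE under the stubs and r5**: `SignedExactCubicForrelationNotPrBPP` (stmt-QuantumAdvantage-13932,
the REAL route decl) is literally `¬ (… ∈ PromiseBPP')` of the same promise problem. -/
theorem SignedExactCubicForrelationNotPrBPP_false_of (h₁ : Registered.stub_flatTransfer)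
    (h₂ : Registered.stub_polarLeak) (h₃ : Registered.stub_bqDichotomy) (h₄ : Registered.stub_finderOfDichotomy)
    (h₅ : Registered.stub_flatSignReadout) (h₆ : Registered.stub_dillonHalfSpace)
    (h5 : ExactPairsMaioranaMcFarland) : ¬ SignedExactCubicForrelationNotPrBPP :=
  fun h3 => h3 (SignedExactCubicForrelationInPrBPP_of h₁ h₂ h₃ h₄ h₅ h₆ h5)

/-! ### Sanity (sorry-free) -/

/-- The negation item is literally `signedExactCubicForrelationProblem 2 ∈ PromiseBPP'` (what `SignReadout` concludes). -/
example : SignedExactCubicForrelationInPrBPP = (signedExactCubicForrelationProblem 2 ∈ PromiseBPP') := rfl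

/-- … and literally the negation of the crux r3. -/
example : SignedExactCubicForrelationInPrBPP ↔ ¬ SignedExactCubicForrelationNotPrBPP := by
  unfold SignedExactCubicForrelationInPrBPP SignedExactCubicForrelationNotPrBPP
  exact not_not.symm

/-- Conversely the crux r3 kills stub 4 or stub 3 or r5 (given the provable stubs 1, 2, 5, 6): the open stubs are
NECESSARY targets of any refutation along this line, not a costume. -/
example (h₁ : FlatTransfer) (h₂ : PolarLeak) (h₅ : SignReadout) (h₆ : DillonOfMM)
    (h5 : ExactPairsMaioranaMcFarland) (h3 : SignedExactCubicForrelationNotPrBPP) :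
    ¬ (BQDichotomy ∧ FinderOfDichotomy) :=
  fun h => h3 (h₅ h₁ (h.2 h₂ h.1) (h₆ h5))

/-- The Gold cube `x ↦ x³` on `𝔽₈ = 𝔽₂[α]/(α³ + α + 1)` in the basis `(1, α, α²)` — the route's designated APN block and
the r7 disprover's witness against "every biquadratic permutation has an affine component"
(`Theorems/SignedCubicForrelationInPrBPP/Negative/GoldCube.lean`). -/
def goldCube (x : Fin 3 → Bool) : Fin 3 → Bool :=
  match x 0, x 1, x 2 with
  | false, false, false => ![false, false, false]
  | true, false, false => ![true, false, false]
  | false, true, false => ![true, true, false]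
  | true, true, false => ![false, false, true]
  | false, false, true => ![true, false, true]
  | true, false, true => ![false, true, true]
  | false, true, true => ![true, true, true]
  | true, true, true => ![false, true, false]

/-- In-Lean small case (kernel `decide`): the Gold cube sits in the RANK-ISOLATING branch of `BQDichotomy` … -/
example : HasIsolatingDirection goldCube := by
  unfold HasIsolatingDirection dkerCard
  decide

/-- … and NOT in the affine-direction branch (consistent with the landed `not_biquadraticPermsHaveAffineComponent`:
the dichotomy never claims affine structure for every `π`). -/
example : ¬ HasAffineDirection goldCube := by
  unfold HasAffineDirection
  decide

end Summit.QuantumAdvantage.QuantumAdvantage.Cruxes.SignedExactCubicForrelationNotPrBPP.StationaryFlatSign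

end
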